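import Summits.BirchSwinnertonDyer.BirchSwinnertonDyer.Theorems.Rank2ObservatoryKrausCert
import HarnessLib

/-!
# X5 at `p = 2` (cell `bsd-2adic`, seat `bsd-2adic-mult`, GEN 7): toolkit — minimality AT `3` for
# integer models with `ord₃ c₆ ∈ {7, 8}` (the elementary half of Kraus's conditions at `3`)

HONEST FRAMING (as in `X5/TwoAdicInstancesToolkit.lean`; nothing asserted about any curve class).
Silverman's sufficient criterion (`q¹² ∤ Δ` or `q⁴ ∤ c₄`) is silent at `3` for Cremona models that are
additive at `3` with `3¹² ∣ Δ`, `3⁴ ∣ c₄` — e.g. the `X5` mult-at-`2` residue classes 24138e, 89910g,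
105138c (GEN 6, never landed) and 232470ba, 386694u, 410670co, 432054s, 490050io, 155682r, 166050ci,
289170r, 376650ed, 484542q (GEN 7). All of them have `ord₃ c₆ = 8`. This file proves, in the pattern of
the rank-`≥ 2` observatory's Tate–Kraus step at `2` (`Rank2ObservatoryKrausMinimality`), the `3`-adic step:

* `kraus_three_weak` — an INTEGRAL Weierstrass equation over `ℤ₃` has `27 ∣ c₆` or `c₆` a `3`-adic
  unit (`c₆ = −b₂³ + 36 b₂b₄ − 216 b₆`: if `3 ∣ b₂` every term is divisible by `27`, else
  `c₆ ≡ −b₂³ ≢ 0 (mod 3)`), i.e. `ord₃ c₆ ∉ {1, 2}` — the necessary half of Kraus's condition at `3`;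
* `isMinimal_padic_three_of_c₆` — hence an integer model with `3⁷ ∣ c₆`, `3⁹ ∤ c₆` is minimal at `3`
  (a `ℚ₃`-isomorphic integral equation has `c₆' = u⁻⁶c₆`; `ord₃ u⁻¹ = 1` would give `ord₃ c₆' ∈ {1,2}`,
  `ord₃ u⁻¹ ≥ 2` would give `ord₃ c₆' < 0`);
* `isMinimalAt_baseChange_int_three_of_c₆`, and the global wrapper
  `isGloballyMinimal_baseChange_int_of_kraus₃` (Kraus at `3` + Silverman's criterion at every other
  prime) with the finite feeder `kraus₃_criterion_of_primeFactors_gcd` (check only the prime factors of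
  `gcd(Δ, c₄)`, a `decide` on literal models).

References: Kraus, Manuscripta Math. 65 (1989), Prop. 2 / §3 (the conditions at `3`) [Kraus1989];
Silverman, AEC VII.1 Remark 1.1, VIII.8 [SilvermanAEC2009]; Cremona 1997 §3.2 [CremonaAlgorithms1997].
-/

set_option autoImplicit false

namespace Summit.BirchSwinnertonDyer.Rank1Residual.X5.Instances

open IsDedekindDomain WeierstrassCurve Literature.NumberTheory.EllipticCurves
  Summit.BirchSwinnertonDyer.BirchSwinnertonDyer.Rank2Observatory

/-! ### Residues in `ℤ₃` and Kraus's necessary condition at `3` -/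

/-- The three residues of `ZMod 3`. [folklore] -/
theorem zmod_three_cases : ∀ z : ZMod 3, z = 0 ∨ z = 1 ∨ z = 2 := by decide

/-- Every `3`-adic integer is `3m`, `3m + 1` or `3m + 2` (the residue field of `ℤ₃` is `𝔽₃`). [folklore] -/
theorem padicInt_three_exists_eq_three_mul_or (x : ℤ_[3]) :
    ∃ m : ℤ_[3], x = 3 * m ∨ x = 3 * m + 1 ∨ x = 3 * m + 2 := by
  have key : ∀ y : ℤ_[3], PadicInt.toZMod y = 0 → (3 : ℤ_[3]) ∣ y := fun y hy => by
    have h : y ∈ RingHom.ker (PadicInt.toZMod (p := 3)) := (RingHom.mem_ker).mpr hy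
    rw [PadicInt.ker_toZMod, PadicInt.maximalIdeal_eq_span_p, Ideal.mem_span_singleton] at h
    simpa using h
  rcases zmod_three_cases (PadicInt.toZMod x) with h | h | h
  · obtain ⟨m, hm⟩ := key x h
    exact ⟨m, Or.inl hm⟩
  · have h' : PadicInt.toZMod (x - 1) = 0 := by rw [map_sub, map_one, h, sub_self]
    obtain ⟨m, hm⟩ := key _ h'
    exact ⟨m, Or.inr (Or.inl (by linear_combination hm))⟩
  · have h' : PadicInt.toZMod (x - 2) = 0 := by
      rw [map_sub, h]
      have : (PadicInt.toZMod (p := 3)) 2 = 2 := by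
        rw [show (2 : ℤ_[3]) = 1 + 1 by norm_num, map_add, map_one]; norm_num
      rw [this, sub_self]
    obtain ⟨m, hm⟩ := key _ h'
    exact ⟨m, Or.inr (Or.inr (by linear_combination hm))⟩

/-- The norm of `3` in `ℚ₃` is `1/3`. [folklore] -/
theorem padic_norm_three : ‖(3 : ℚ_[3])‖ = 3⁻¹ := by
  simpa using Padic.norm_p (p := 3)

/-- `‖3w + 1‖₃ = 1` and `‖3w − 1‖₃ = 1` for `w ∈ ℤ₃` (ultrametric inequality). [folklore] -/
theorem norm_three_mul_add_unit (w : ℤ_[3]) (ε : ℤ_[3]) (hε : ε = 1 ∨ ε = -1) :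
    ‖((3 * w + ε : ℤ_[3]) : ℚ_[3])‖ = 1 := by
  rw [PadicInt.padic_norm_e_of_padicInt]
  have hε1 : ‖ε‖ = 1 := by
    rcases hε with rfl | rfl <;> simp
  have h3 : ‖(3 : ℤ_[3])‖ = 3⁻¹ := by simpa using PadicInt.norm_p (p := 3)
  have h3w : ‖(3 : ℤ_[3]) * w‖ < 1 := by
    rw [norm_mul, h3]
    calc (3 : ℝ)⁻¹ * ‖w‖ ≤ 3⁻¹ * 1 := by gcongr; exact PadicInt.norm_le_one w
      _ < 1 := by norm_num
  have hne : ‖(3 : ℤ_[3]) * w‖ ≠ ‖ε‖ := by rw [hε1]; exact h3w.ne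
  rw [IsUltrametricDist.norm_add_eq_max_of_norm_ne_norm hne, hε1]
  exact max_eq_right h3w.le

/-- **Kraus's condition at `3`, necessary half (weak form).** An integral Weierstrass equation over `ℤ₃`
has `27 ∣ c₆` (when `3 ∣ b₂`: every term of `c₆ = −b₂³ + 36 b₂ b₄ − 216 b₆` is divisible by `27`) or
`c₆` is a `3`-adic unit (when `b₂ = 3m ± 1`: `c₆ ≡ −b₂³ ≡ ∓1 (mod 3)`); i.e. `ord₃ c₆ ∉ {1, 2}`.
[cite: Kraus1989, Prop. 2] -/
theorem kraus_three_weak (Y : WeierstrassCurve ℤ_[3]) :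
    (27 : ℤ_[3]) ∣ Y.c₆ ∨ ‖((Y.c₆ : ℤ_[3]) : ℚ_[3])‖ = 1 := by
  obtain ⟨m, hm | hm | hm⟩ := padicInt_three_exists_eq_three_mul_or Y.b₂
  · refine Or.inl ⟨-m ^ 3 + 4 * m * Y.b₄ - 8 * Y.b₆, ?_⟩
    simp only [WeierstrassCurve.c₆, hm]
    ring
  · right
    have hc : Y.c₆ = 3 * (-9 * m ^ 3 - 9 * m ^ 2 - 3 * m + 12 * (3 * m + 1) * Y.b₄ - 72 * Y.b₆) + (-1) := by
      simp only [WeierstrassCurve.c₆, hm]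
      ring
    rw [hc]
    exact norm_three_mul_add_unit _ _ (Or.inr rfl)
  · right
    have hc : Y.c₆ =
        3 * (-9 * m ^ 3 - 18 * m ^ 2 - 12 * m - 3 + 12 * (3 * m + 2) * Y.b₄ - 72 * Y.b₆) + 1 := by
      simp only [WeierstrassCurve.c₆, hm]
      ring
    rw [hc]
    exact norm_three_mul_add_unit _ _ (Or.inl rfl)

/-- `‖k‖₃ ≤ 3⁻ⁿ` for an integer `k` means `3ⁿ ∣ k`. [folklore] -/
theorem three_pow_dvd_iff_norm_le (k : ℤ) (n : ℕ) :
    ‖(k : ℚ_[3])‖ ≤ (3 : ℝ) ^ (-(n : ℤ)) ↔ (3 : ℤ) ^ n ∣ k := by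
  have h := Padic.norm_int_le_pow_iff_dvd (p := 3) k n
  exact_mod_cast h

/-! ### The Tate–Kraus step at `3`: `3⁷ ∣ c₆`, `3⁹ ∤ c₆` ⟹ minimal at `3` -/

/-- **Minimality at `3` from `ord₃ c₆ ∈ {7, 8}`.** For `W₀ / ℤ` with `3⁷ ∣ c₆` and `3⁹ ∤ c₆`, the
equation `W₀ ⊗ ℚ₃` is a minimal Weierstrass equation over `ℤ₃` (Mathlib's `WeierstrassCurve.IsMinimal`):
an integral `ℚ₃`-isomorphic equation `C • W₀` with `ord₃ u⁻¹ ≥ 1` has integral `c₆' = u⁻⁶ c₆`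
(Silverman AEC VII.1.3) with `ord₃ c₆' = ord₃ c₆ − 6 ord₃ u⁻¹ ∈ {1, 2}` if `ord₃ u⁻¹ = 1` — excluded by
`kraus_three_weak` — and `< 0` if `ord₃ u⁻¹ ≥ 2` — excluded by integrality. [cite: Kraus1989, Prop. 2] -/
theorem isMinimal_padic_three_of_c₆ (W₀ : WeierstrassCurve ℤ)
    (h7 : (3 : ℤ) ^ 7 ∣ W₀.c₆) (h9 : ¬ (3 : ℤ) ^ 9 ∣ W₀.c₆) :
    ((W₀.baseChange ℚ).baseChange ℚ_[3]).IsMinimal ℤ_[3] := by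
  set X := (W₀.baseChange ℚ).baseChange ℚ_[3] with hX
  have hV : ∀ x : ℚ_[3], NormedField.valuation x ≤ 1 ↔ x ∈ (algebraMap ℤ_[3] ℚ_[3]).range := by
    intro x
    rw [NormedField.valuation_apply, ← NNReal.coe_le_coe, coe_nnnorm, NNReal.coe_one]
    constructor
    · intro hx
      exact ⟨⟨x, hx⟩, by rw [PadicInt.algebraMap_apply]⟩
    · rintro ⟨z, rfl⟩
      rw [PadicInt.algebraMap_apply, PadicInt.padic_norm_e_of_padicInt]
      exact PadicInt.norm_le_one z
  have hc₆X : X.c₆ = (W₀.c₆ : ℚ_[3]) := by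
    simp [hX, WeierstrassCurve.baseChange, WeierstrassCurve.map_c₆]
  rw [isMinimal_iff_of_le_one_iff hV]
  refine ⟨⟨⟨W₀.map (Int.castRingHom ℤ_[3]), ?_⟩⟩, fun C hC => ?_⟩
  · have hφ : (algebraMap ℚ ℚ_[3]).comp (algebraMap ℤ ℚ) =
        (algebraMap ℤ_[3] ℚ_[3]).comp (Int.castRingHom ℤ_[3]) := Subsingleton.elim _ _
    simp only [hX, WeierstrassCurve.baseChange, WeierstrassCurve.map_map, hφ]
  simp only [NormedField.valuation_apply, ← NNReal.coe_le_coe, coe_nnnorm, variableChange_Δ,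
    norm_mul, norm_pow]
  set x : ℚ_[3] := ((C.u⁻¹ : ℚ_[3]ˣ) : ℚ_[3]) with hx
  by_cases hx1 : ‖x‖ ≤ 1
  · exact mul_le_of_le_one_left (norm_nonneg _) (pow_le_one₀ (norm_nonneg _) hx1)
  exfalso
  rw [not_le] at hx1
  haveI := hC
  set Y := WeierstrassCurve.integralModel ℤ_[3] (C • X) with hY
  have hY6 : ((Y.c₆ : ℤ_[3]) : ℚ_[3]) = x ^ 6 * (W₀.c₆ : ℚ_[3]) := by
    rw [← PadicInt.algebraMap_apply, hY, WeierstrassCurve.integralModel_c₆_eq, variableChange_c₆,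
      hc₆X]
  have hx0 : x ≠ 0 := by
    intro h
    rw [h, norm_zero] at hx1
    exact absurd hx1 (by norm_num)
  -- `‖x‖ = 3 ^ e` with `e ≥ 1`
  have three_le : (3 : ℝ) ≤ ‖x‖ := by
    rw [Padic.norm_eq_zpow_neg_valuation hx0] at hx1 ⊢
    have he : 0 < -x.valuation := (one_lt_zpow_iff_right₀ (by norm_num : (1 : ℝ) < 3)).mp hx1
    calc (3 : ℝ) = 3 ^ (1 : ℤ) := by norm_num
      _ ≤ 3 ^ (-x.valuation) := zpow_le_zpow_right₀ (by norm_num) (by omega)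
  -- the integer `c₆`: `3⁻⁸ ≤ ‖c₆‖ ≤ 3⁻⁷` (we use `‖c₆‖ ≤ 3⁻⁷` and `‖c₆‖ > 3⁻⁹`)
  set c : ℝ := ‖(W₀.c₆ : ℚ_[3])‖ with hc
  have hc7 : c ≤ 1 / 2187 := by
    have := (three_pow_dvd_iff_norm_le W₀.c₆ 7).mpr h7
    norm_num at this
    exact this
  have hc9 : 1 / 19683 < c := by
    rw [← not_le]
    intro hle
    apply h9
    apply (three_pow_dvd_iff_norm_le W₀.c₆ 9).mp
    norm_num
    exact hle
  -- `c₆' = x⁶ c₆` is integral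
  have hY6n : ‖x‖ ^ 6 * c ≤ 1 := by
    rw [hc, ← norm_pow, ← norm_mul, ← hY6, PadicInt.padic_norm_e_of_padicInt]
    exact PadicInt.norm_le_one _
  have h729 : (729 : ℝ) ≤ ‖x‖ ^ 6 := by
    calc (729 : ℝ) = 3 ^ 6 := by norm_num
      _ ≤ ‖x‖ ^ 6 := pow_le_pow_left₀ (by norm_num) three_le 6
  rcases kraus_three_weak Y with ⟨w, hw⟩ | hunit
  · -- `27 ∣ c₆'`: `‖x‖⁶ c = ‖27 w‖ ≤ 1/27`, but `‖x‖⁶ c ≥ 729 c > 729/19683 = 1/27`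
    have h27 : ‖x‖ ^ 6 * c ≤ 1 / 27 := by
      rw [hc, ← norm_pow, ← norm_mul, ← hY6, hw, PadicInt.coe_mul, norm_mul,
        PadicInt.padic_norm_e_of_padicInt w]
      have e27 : ‖((27 : ℤ_[3]) : ℚ_[3])‖ = 1 / 27 := by
        have c27 : ((27 : ℤ_[3]) : ℚ_[3]) = 27 := by exact_mod_cast PadicInt.coe_natCast (p := 3) 27
        rw [c27, show (27 : ℚ_[3]) = 3 ^ 3 by norm_num, norm_pow, padic_norm_three]
        norm_num
      rw [e27]
      calc 1 / 27 * ‖w‖ ≤ 1 / 27 * 1 := by gcongr; exact PadicInt.norm_le_one w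
        _ = 1 / 27 := by ring
    have hlow : (729 : ℝ) * (1 / 19683) < ‖x‖ ^ 6 * c :=
      calc (729 : ℝ) * (1 / 19683) < 729 * c := by gcongr
        _ ≤ ‖x‖ ^ 6 * c := mul_le_mul_of_nonneg_right h729 (by linarith)
    linarith
  · -- `c₆'` a unit: `‖x‖⁶ c = 1`; with `c ≤ 3⁻⁷`, `‖x‖⁶ ≥ 3⁷ > 3⁶`, so `‖x‖ ≥ 9`, so `‖x‖⁶ c > 1`
    have heq : ‖x‖ ^ 6 * c = 1 := by
      rw [hc, ← norm_pow, ← norm_mul, ← hY6, hunit]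
    have hgt3 : (3 : ℝ) < ‖x‖ := by
      by_contra hle
      rw [not_lt] at hle
      have h6 : ‖x‖ ^ 6 ≤ 729 := by
        calc ‖x‖ ^ 6 ≤ 3 ^ 6 := pow_le_pow_left₀ (norm_nonneg _) hle 6
          _ = 729 := by norm_num
      have : ‖x‖ ^ 6 * c ≤ 729 * (1 / 2187) :=
        mul_le_mul h6 hc7 (by linarith) (by norm_num)
      linarith
    have nine_le : (9 : ℝ) ≤ ‖x‖ := by
      rw [Padic.norm_eq_zpow_neg_valuation hx0] at hgt3 ⊢
      have hv : 1 < -x.valuation := by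
        by_contra hge
        rw [not_lt] at hge
        have h' : (3 : ℝ) ^ (-x.valuation) ≤ 3 ^ (1 : ℤ) := zpow_le_zpow_right₀ (by norm_num) hge
        have e3 : (3 : ℝ) ^ (1 : ℤ) = 3 := by norm_num
        have hgt3' : (3 : ℝ) < (3 : ℝ) ^ (-x.valuation) := hgt3
        linarith
      calc (9 : ℝ) = 3 ^ (2 : ℤ) := by norm_num
        _ ≤ 3 ^ (-x.valuation) := zpow_le_zpow_right₀ (by norm_num) (by omega)
    have h6 : (531441 : ℝ) ≤ ‖x‖ ^ 6 := by
      calc (531441 : ℝ) = 9 ^ 6 := by norm_num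
        _ ≤ ‖x‖ ^ 6 := pow_le_pow_left₀ (by norm_num) nine_le 6
    have hbig : (531441 : ℝ) * (1 / 19683) < ‖x‖ ^ 6 * c :=
      calc (531441 : ℝ) * (1 / 19683) < 531441 * c := by gcongr
        _ ≤ ‖x‖ ^ 6 * c := mul_le_mul_of_nonneg_right h6 (by linarith)
    linarith

/-- **Minimal at the place of `ℤ` over `3`** (the tree's `IsMinimalAt`, via the transport
`isMinimalAt_iff_isMinimal_padic`). [cite: Kraus1989, Prop. 2] -/
theorem isMinimalAt_baseChange_int_three_of_c₆ (W₀ : WeierstrassCurve ℤ)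
    (h7 : (3 : ℤ) ^ 7 ∣ W₀.c₆) (h9 : ¬ (3 : ℤ) ^ 9 ∣ W₀.c₆) {v : HeightOneSpectrum ℤ}
    (hv : Rat.HeightOneSpectrum.natGenerator v = 3) : (W₀.baseChange ℚ).IsMinimalAt v := by
  exact (isMinimalAt_iff_isMinimal_padic v 3 hv _).mpr (isMinimal_padic_three_of_c₆ W₀ h7 h9)

/-- **Global minimality with the Tate–Kraus step at `3`.** If `3⁷ ∣ c₆`, `3⁹ ∤ c₆`, and every prime
`q ≠ 3` has `q¹² ∤ Δ` or `q⁴ ∤ c₄`, then `W₀ ⊗ ℚ` is a global minimal equation (Silverman AEC VIII.8: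
minimal at every prime). [cite: SilvermanAEC2009, VII.1 Remark 1.1] -/
theorem isGloballyMinimal_baseChange_int_of_kraus₃ (W₀ : WeierstrassCurve ℤ)
    (h7 : (3 : ℤ) ^ 7 ∣ W₀.c₆) (h9 : ¬ (3 : ℤ) ^ 9 ∣ W₀.c₆)
    (hmin : ∀ q : ℕ, q.Prime → q ≠ 3 → ¬ ((q : ℤ) ^ 12 ∣ W₀.Δ ∧ (q : ℤ) ^ 4 ∣ W₀.c₄)) :
    (W₀.baseChange ℚ).IsGloballyMinimal := by
  refine isGloballyMinimal_of_forall_isMinimalAt_int _ fun v => ?_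
  by_cases hv : Rat.HeightOneSpectrum.natGenerator v = 3
  · exact isMinimalAt_baseChange_int_three_of_c₆ W₀ h7 h9 hv
  · rcases not_and_or.mp (hmin _ (Rat.HeightOneSpectrum.prime_natGenerator v) hv) with h | h
    · exact isMinimalAt_baseChange_int_of_not_pow_dvd_Δ h
    · exact isMinimalAt_baseChange_int_of_not_pow_four_dvd_c₄ h

/-- **The away-from-`3` part is a finite check at the prime factors of `gcd(Δ, c₄)`**: if `Δ ≠ 0` and
every prime factor `q` of `gcd(Δ, c₄)` is `3` or fails `q¹² ∣ Δ ∧ q⁴ ∣ c₄`, then every prime `q ≠ 3` fails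
it (a prime with `q¹² ∣ Δ` and `q⁴ ∣ c₄` divides the gcd). A `decide` on literal models.
[cite: SilvermanAEC2009, VII.1 Remark 1.1] -/
theorem kraus₃_criterion_of_primeFactors_gcd {D C : ℤ} (hD : D ≠ 0)
    (h : ∀ q ∈ (Int.gcd D C).primeFactors, q = 3 ∨ ¬ ((q : ℤ) ^ 12 ∣ D ∧ (q : ℤ) ^ 4 ∣ C))
    (q : ℕ) (hq : q.Prime) (hq3 : q ≠ 3) : ¬ ((q : ℤ) ^ 12 ∣ D ∧ (q : ℤ) ^ 4 ∣ C) := by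
  rintro ⟨h12, h4⟩
  have hqD : (q : ℤ) ∣ D := (dvd_pow_self (q : ℤ) (by norm_num)).trans h12
  have hqC : (q : ℤ) ∣ C := (dvd_pow_self (q : ℤ) (by norm_num)).trans h4
  have hg : (q : ℤ) ∣ (Int.gcd D C : ℤ) := Int.dvd_coe_gcd hqD hqC
  have hg' : q ∣ Int.gcd D C := by exact_mod_cast hg
  have hg0 : Int.gcd D C ≠ 0 := fun h0 ↦ hD (Int.gcd_eq_zero_iff.mp h0).1
  rcases h q (Nat.mem_primeFactors.mpr ⟨hq, hg', hg0⟩) with h3 | hn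
  · exact hq3 h3
  · exact hn ⟨h12, h4⟩

/-- **Global minimality of an integer model from `ord₃ c₆ ∈ {7,8}` and the `gcd` check** — the form the
instance files use (`W₀.baseChange ℚ` for a literal `W₀`; both hypotheses by `decide`).
[cite: Kraus1989, Prop. 2] [cite: SilvermanAEC2009, VII.1 Remark 1.1] -/
theorem isGloballyMinimal_baseChange_int_of_kraus₃_gcd (W₀ : WeierstrassCurve ℤ) (hΔ : W₀.Δ ≠ 0)
    (h7 : (3 : ℤ) ^ 7 ∣ W₀.c₆) (h9 : ¬ (3 : ℤ) ^ 9 ∣ W₀.c₆)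
    (h : ∀ q ∈ (Int.gcd W₀.Δ W₀.c₄).primeFactors,
      q = 3 ∨ ¬ ((q : ℤ) ^ 12 ∣ W₀.Δ ∧ (q : ℤ) ^ 4 ∣ W₀.c₄)) :
    (W₀.baseChange ℚ).IsGloballyMinimal :=
  isGloballyMinimal_baseChange_int_of_kraus₃ W₀ h7 h9 (kraus₃_criterion_of_primeFactors_gcd hΔ h)

end Summit.BirchSwinnertonDyer.Rank1Residual.X5.Instances
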